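import Literature.AlgebraicGeometry.RelativeSpec.GeometricQuotientFreeBasePullback
import Literature.AlgebraicGeometry.RelativeSpec.GeometricQuotientFreeEquivariantDescent
import Literature.AlgebraicGeometry.AbelianSchemes.AbelianSchemeOverBase
import Literature.AlgebraicGeometry.Morphisms.FiniteEtaleFpqcDescent
import Literature.AlgebraicGeometry.LaurentSchroer2023.ParaAbelianGroupLawHolds
import Mathlib.AlgebraicGeometry.Morphisms.LocalFlatDescent
import HarnessLib

/-!
# An abelian scheme descends along a free finite quotient OF THE BASE
# ([MFK94] Ch. 7 §1 Prop. 7.1 / §3 remark after Thm. 7.9, Lemma 7.11; SGA 1 VIII 7.8 — finite-group form)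

Topic `AlgebraicGeometry/AbelianSchemes`; namespace `Literature.AlgebraicGeometry.AbelianSchemes.AbelianSchemeOver`.
THEOREMS ONLY (no definition, no named fact, no instance, no notation, no `sorry`; net Literature debt 0).
Cell hodgecm-mathlib (D-0151), F-DAG price sheet leaf F-10 (10a) «the universal triple DESCENDS along the free
finite quotient of the base `M → M/Γ`» (level lowering `A_{g,δ,N} = A_{g,δ,NK}/Γ`), FIRST HALF: the abelian
scheme and its group law.  HC_CM is proved only modulo the 7 printed citations until rung 0 closes; this file
discharges none of them (count-neutral capital).

SETTING.  `p : S → Q` an AFFINE geometric quotient of the scheme `S` by a FREE action `ρ` of the finite group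
`G` (ring-form freeness, as in every free-quotient file of the tree); `A` an abelian scheme over `S`;
`π : A → B₀` an affine geometric quotient of the total space by an action `ρA` of `G` which COVERS `ρ` BY
ISOMORPHISMS OF GROUP SCHEMES: for every `g`, `ρA(g)` exhibits `A` as the base change of `A` along `ρ(g)`
(★ `AbelianSchemeOver.IsBaseChangeVia`: cartesian square over `ρ(g)`, compatible with unit and multiplication —
the datum the moduli functor produces from `classify` and the twisted level structures); `b : B₀ → Q` the
induced map (`π ≫ b = A.hom ≫ p`); `B₀` separated.

RESULT `exists_grpObj_isBaseChangeVia_of_free_base_quotient`: **`B₀ → Q` carries a structure of abelian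
scheme over `Q` — a group law (`GrpObj (Over.mk b)`), proper, smooth, with geometrically connected fibres —
for which `π` exhibits `A` as its base change along `p`** (`A.IsBaseChangeVia B p π`; uniqueness of such a
structure is then ★ `PolarizedAbelianSchemeWithLevelBaseChangeUnique` for free).

PROOF.  (1) The square `(A → S, A → B₀; p, b)` is CARTESIAN: effective descent along the free finite quotient,
★ `IsGeometricQuotient.isPullback_of_equivariant_of_free`.  (2) Hence `A ×_S A → B₀ ×_Q B₀` (and `π`, `p`)
are base changes of `p`: flat surjective quasi-compact EPIMORPHISMS, and `A ×_S A → B₀ ×_Q B₀` is a geometric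
quotient for the diagonal action (★ `GeometricQuotientFreeBasePullback`).  (3) The law `μ ≫ π : A ×_S A → B₀`,
the unit `η ≫ π : S → B₀` and the inverse `ι ≫ π` are `G`-INVARIANT (unit/multiplication compatibility of
`ρA(g)`; for the inverse: uniqueness of inverses in the monoid `Hom_Q(A, B)` once the monoid structure of `B`
is in place), so they DESCEND (★ `IsGeometricQuotient.desc`) to `μ_B : B ⊗ B → B`, `η_B : 𝟙 → B`,
`ι_B : B → B` in `Over Q`.  (4) Every monoid/group axiom of `B` is the image of the corresponding axiom of `A`
under the epimorphisms of (2) (`cancel_epi`, with Mathlib's `.left` formulas for the cartesian-monoidal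
structure of `Over`).  (5) `b` is proper (★ `isProper_of_isPullback`, separatedness ★
`isSeparated_of_isPullback`), smooth (Mathlib: smoothness descends along flat surjective quasi-compact maps)
and geometrically connected (★ `geometricallyConnected_of_isPullback_of_surjective`).  (6) The
`IsBaseChangeVia` clauses are the cartesian square of (1) and the defining equations of `η_B`, `μ_B`.

Mathlib searched (pin): `GrpObj`, `MonObj`, `CartesianMonoidalCategory (Over X)` + `Over.tensorObj_left`,
`Over.whiskerRight_left(_fst/_snd)`, `Over.whiskerLeft_left_fst/_snd`, `Over.associator_hom_left_*`,
`Over.leftUnitor_hom_left`, `Over.rightUnitor_hom_left`, `Over.lift_left`, `Over.toUnit_left`,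
`MonObj.Hom.monoid`/`Hom.mul_def`/`Hom.one_def`, `MorphismProperty.of_isPullback_of_descendsAlong` (Smooth),
`Flat.epi_of_flat_of_surjective` (all used); Mathlib has no quotients of schemes by finite groups.

## References
* D. Mumford, J. Fogarty, F. Kirwan, *Geometric Invariant Theory*, 3rd ed. (1994), Ch. 7 §1 Prop. 7.1
  (p. 127); §3, remark after Thm. 7.9 and Lemma 7.11 (pp. 139–140). [MumfordFogartyKirwan1994]
* A. Grothendieck, *SGA 1*, Exp. VIII Cor. 7.8; Exp. V Prop. 2.6, Déf. 2.7. [SGA1]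
* D. Mumford, *Abelian Varieties* (1970), §7 Thm. p. 66 and Thm. 4 (p. 72). [MumfordAV1970]
-/

noncomputable section

universe u

open CategoryTheory Limits AlgebraicGeometry MonoidalCategory CartesianMonoidalCategory MonObj

namespace Literature.AlgebraicGeometry.AbelianSchemes.AbelianSchemeOver

open Literature.AlgebraicGeometry.RelativeSpec Literature.AlgebraicGeometry.RelativeSpec.ActionOver

set_option backward.isDefEq.respectTransparency false

variable {S Q : Scheme.{u}} {p : S ⟶ Q} {G : Type u} [Group G] [Fintype G] {ρ : ActionOver p G}
  (hq : ρ.IsGeometricQuotient p) [IsAffineHom p]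
  (hfree : ∀ (V : Q.Opens), IsAffineOpen V → ∀ g : G, g ≠ 1 →
    Ideal.span (Set.range fun s : Γ(S, p ⁻¹ᵁ V) ↦ ρ.act g V s - s) = ⊤)
  (A : AbelianSchemeOver S) {B₀ : Scheme.{u}} {π : A.X.left ⟶ B₀} {ρA : ActionOver π G}
  (hπ : ρA.IsGeometricQuotient π) [IsAffineHom π] [B₀.IsSeparated]
  (hA : ∀ g : G, A.IsBaseChangeVia A (ρ.aut g).hom (ρA.aut g).hom)
  (b : B₀ ⟶ Q) (hb : A.X.hom ≫ p = π ≫ b)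

include hq hfree hπ hA hb

/-- **AN ABELIAN SCHEME DESCENDS ALONG A FREE FINITE QUOTIENT OF THE BASE.**  In the SETTING of the module
docstring: the `Q`-scheme `b : B₀ → Q` (the quotient of the total space of `A` by the `G`-action covering the
free action on the base `S`, `Q = S/G`) carries a group law, is proper and smooth with geometrically connected
fibres — an abelian scheme `B` over `Q` — and `π : A → B₀` exhibits `A` as the base change of `B` along
`p : S → Q` AS GROUP SCHEMES (★ `IsBaseChangeVia`: cartesian square, units and laws compatible).
[cite: MumfordFogartyKirwan1994, Ch. 7 §1 Prop. 7.1 (p. 127) and §3 Lemma 7.11 (p. 140)]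
[cite: SGA1, Exp. VIII Cor. 7.8] [cite: MumfordAV1970, §7 Thm. 4 (p. 72)] -/
theorem exists_grpObj_isBaseChangeVia_of_free_base_quotient :
    ∃ (grp : GrpObj (Over.mk b)) (hpr : IsProper b) (hsm : Smooth b) (hgc : GeometricallyConnected b),
      A.IsBaseChangeVia (@AbelianSchemeOver.mk Q (Over.mk b) grp hpr hsm hgc) p π := by
  -- ### (0) the action data
  have hw : ∀ g : G, (ρA.aut g).hom ≫ A.X.hom = A.X.hom ≫ (ρ.aut g).hom := fun g => (hA g).fst
  have hunit : ∀ g : G, η[A.X].left ≫ (ρA.aut g).hom = (ρ.aut g).hom ≫ η[A.X].left :=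
    fun g => (hA g).snd.2.1
  have hmul : ∀ g : G, μ[A.X].left ≫ (ρA.aut g).hom =
      pullback.map A.X.hom A.X.hom A.X.hom A.X.hom (ρA.aut g).hom (ρA.aut g).hom (ρ.aut g).hom
        (hw g).symm (hw g).symm ≫ μ[A.X].left := fun g => (hA g).snd.2.2
  -- ### (1) the cartesian square `A ≅ S ×_Q B₀`
  have hb' : π ≫ (Over.mk b).hom = A.X.hom ≫ p := hb.symm
  have HA : IsPullback A.X.hom π p (Over.mk b).hom :=
    hq.isPullback_of_equivariant_of_free hfree hπ A.X.hom (Over.mk b).hom hw hb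
  have H2 : IsPullback (A.X ⊗ A.X).hom (pullback.map A.X.hom A.X.hom (Over.mk b).hom (Over.mk b).hom π π p HA.w HA.w) p (Over.mk b ⊗ Over.mk b).hom :=
    isPullback_fst_comp_map HA HA
  -- flat / surjective / epi
  haveI : Flat p := hq.flat_of_free hfree
  haveI : Surjective p := ⟨hq.surjective⟩
  haveI : QuasiCompact p := hq.quasiCompact
  haveI : Epi p := Flat.epi_of_flat_of_surjective p
  haveI : Flat π := hπ.flat_of_free (IsGeometricQuotient.free_of_equivariant (ρ := ρ) hfree ρA A.X.hom hw)
  haveI : Surjective π := ⟨hπ.surjective⟩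
  haveI : Epi π := Flat.epi_of_flat_of_surjective π
  haveI : Epi (pullback.map A.X.hom A.X.hom (Over.mk b).hom (Over.mk b).hom π π p HA.w HA.w) := hq.epi_pullbackMap_of_free hfree HA HA
  haveI : Epi (pullback.map (A.X ⊗ A.X).hom A.X.hom (Over.mk b ⊗ Over.mk b).hom (Over.mk b).hom
        (pullback.map A.X.hom A.X.hom (Over.mk b).hom (Over.mk b).hom π π p HA.w HA.w) π p H2.w HA.w) :=
    hq.epi_pullbackMap_of_free hfree H2 HA
  -- ### (2) the diagonal action on `A ×_S A` has `A ×_S A → B₀ ×_Q B₀` as a geometric quotient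
  have hq2 := hq.isGeometricQuotient_onPullback_map_of_free hfree HA ρA hw HA ρA hw
  have haut2 : ∀ g : G, ((ActionOver.onPullback A.X.hom A.X.hom ρA.aut ρA.aut ρ.aut hw hw (pullback.map A.X.hom A.X.hom (Over.mk b).hom (Over.mk b).hom π π p HA.w HA.w)
      (IsGeometricQuotient.pullbackMapHom_comp_map ρA hw HA.w ρA hw HA.w)).aut g).hom =
      pullback.map A.X.hom A.X.hom A.X.hom A.X.hom (ρA.aut g).hom (ρA.aut g).hom (ρ.aut g).hom
        (hw g).symm (hw g).symm := fun g => rfl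
  -- ### (3) descent of the law and of the unit
  have hinvμ : ∀ g : G, ((ActionOver.onPullback A.X.hom A.X.hom ρA.aut ρA.aut ρ.aut hw hw (pullback.map A.X.hom A.X.hom (Over.mk b).hom (Over.mk b).hom π π p HA.w HA.w)
      (IsGeometricQuotient.pullbackMapHom_comp_map ρA hw HA.w ρA hw HA.w)).aut g).hom ≫
      (μ[A.X].left ≫ π) = μ[A.X].left ≫ π := fun g => by
    rw [haut2, ← Category.assoc, ← hmul g, Category.assoc, ρA.aut_comp]
  obtain ⟨mB, hmB⟩ : ∃ mB : pullback (Over.mk b).hom (Over.mk b).hom ⟶ B₀, pullback.map A.X.hom A.X.hom (Over.mk b).hom (Over.mk b).hom π π p HA.w HA.w ≫ mB = μ[A.X].left ≫ π :=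
    ⟨hq2.desc _ hinvμ, hq2.comp_desc _ hinvμ⟩
  have hinvη : ∀ g : G, (ρ.aut g).hom ≫ (η[A.X].left ≫ π) = η[A.X].left ≫ π := fun g => by
    rw [← Category.assoc, ← hunit g, Category.assoc, ρA.aut_comp]
  obtain ⟨nB, hnB⟩ : ∃ nB : Q ⟶ B₀, p ≫ nB = η[A.X].left ≫ π := ⟨hq.desc _ hinvη, hq.comp_desc _ hinvη⟩
  -- the structure maps are over `Q`
  have hmBw : mB ≫ (Over.mk b).hom = (Over.mk b ⊗ Over.mk b).hom := by
    rw [← cancel_epi (pullback.map A.X.hom A.X.hom (Over.mk b).hom (Over.mk b).hom π π p HA.w HA.w), reassoc_of% hmB, hb', ← Category.assoc, Over.w μ[A.X]]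
    exact H2.w
  have hnBw : nB ≫ (Over.mk b).hom = (𝟙_ (Over Q)).hom := by
    rw [← cancel_epi p, reassoc_of% hnB, hb', ← Category.assoc, Over.w η[A.X]]
    exact (Category.id_comp p).trans (Category.comp_id p).symm
  -- ### (4) the monoid object `B = (B₀ → Q)` of `Over Q`
  let μB : Over.mk b ⊗ Over.mk b ⟶ Over.mk b := Over.homMk mB hmBw
  let ηB : 𝟙_ (Over Q) ⟶ Over.mk b := Over.homMk nB hnBw
  have hμB : μB.left = mB := rfl
  have hηB : ηB.left = nB := rfl
  -- `π` is compatible with units and laws (the defining equations of `η_B`, `μ_B`), in `.left` form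
  have cη : (toUnit A.X ≫ η[A.X]).left ≫ π = π ≫ (toUnit (Over.mk b) ≫ ηB).left := by
    rw [Over.comp_left, Over.comp_left, Over.toUnit_left, Over.toUnit_left, hηB, Category.assoc, ← hnB,
      reassoc_of% hb]
    rfl
  have cμ : pullback.map A.X.hom A.X.hom (Over.mk b).hom (Over.mk b).hom π π p HA.w HA.w ≫ μB.left = μ[A.X].left ≫ π := hmB
  have cid : (𝟙 A.X : A.X ⟶ A.X).left ≫ π = π ≫ (𝟙 (Over.mk b) : Over.mk b ⟶ Over.mk b).left := by
    rw [Over.id_left, Over.id_left, Category.id_comp]; exact (Category.comp_id π).symm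
  -- (L1) left unit and (L2) right unit, in `lift` form at the test object `B`
  have L1 : lift (toUnit (Over.mk b) ≫ ηB) (𝟙 (Over.mk b)) ≫ μB = 𝟙 (Over.mk b) := by
    ext
    rw [Over.comp_left, ← cancel_epi π, ← Category.assoc,
      OverBaseMap.comp_lift_left p (toUnit A.X ≫ η[A.X]) (𝟙 A.X) (toUnit (Over.mk b) ≫ ηB) (𝟙 (Over.mk b))
        π π π HA.w HA.w cη cid, Category.assoc, cμ, ← Category.assoc, ← Over.comp_left,
      MonObj.lift_comp_one_left, Over.id_left, Over.id_left, Category.id_comp]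
    exact (Category.comp_id π).symm
  have L2 : lift (𝟙 (Over.mk b)) (toUnit (Over.mk b) ≫ ηB) ≫ μB = 𝟙 (Over.mk b) := by
    ext
    rw [Over.comp_left, ← cancel_epi π, ← Category.assoc,
      OverBaseMap.comp_lift_left p (𝟙 A.X) (toUnit A.X ≫ η[A.X]) (𝟙 (Over.mk b)) (toUnit (Over.mk b) ≫ ηB)
        π π π HA.w HA.w cid cη, Category.assoc, cμ, ← Category.assoc, ← Over.comp_left,
      MonObj.lift_comp_one_right, Over.id_left, Over.id_left, Category.id_comp]
    exact (Category.comp_id π).symm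
  -- (L3) associativity, in `lift` form at the test object `(B ⊗ B) ⊗ B`
  have hA3 : lift (fst (A.X ⊗ A.X) A.X ≫ μ[A.X]) (snd (A.X ⊗ A.X) A.X) ≫ μ[A.X] =
      lift (fst (A.X ⊗ A.X) A.X ≫ fst A.X A.X) (lift (fst (A.X ⊗ A.X) A.X ≫ snd A.X A.X) (snd (A.X ⊗ A.X) A.X) ≫ μ[A.X]) ≫ μ[A.X] := by
    have h := MonObj.lift_lift_assoc (fst (A.X ⊗ A.X) A.X ≫ fst A.X A.X) (fst (A.X ⊗ A.X) A.X ≫ snd A.X A.X) (snd (A.X ⊗ A.X) A.X)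
    rwa [← comp_lift, lift_fst_snd, Category.comp_id] at h
  have c1 : (fst (A.X ⊗ A.X) A.X ≫ μ[A.X]).left ≫ π =
      pullback.map (A.X ⊗ A.X).hom A.X.hom (Over.mk b ⊗ Over.mk b).hom (Over.mk b).hom
        (pullback.map A.X.hom A.X.hom (Over.mk b).hom (Over.mk b).hom π π p HA.w HA.w) π p H2.w HA.w ≫ (fst (Over.mk b ⊗ Over.mk b) (Over.mk b) ≫ μB).left := by
    simp only [Over.comp_left, Over.fst_left, Category.assoc, pullback.lift_fst_assoc, cμ]
  have c2 : (snd (A.X ⊗ A.X) A.X).left ≫ π =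
      pullback.map (A.X ⊗ A.X).hom A.X.hom (Over.mk b ⊗ Over.mk b).hom (Over.mk b).hom
        (pullback.map A.X.hom A.X.hom (Over.mk b).hom (Over.mk b).hom π π p HA.w HA.w) π p H2.w HA.w ≫ (snd (Over.mk b ⊗ Over.mk b) (Over.mk b)).left := by
    simp only [Over.snd_left, pullback.lift_snd]
  have c3 : (fst (A.X ⊗ A.X) A.X ≫ fst A.X A.X).left ≫ π =
      pullback.map (A.X ⊗ A.X).hom A.X.hom (Over.mk b ⊗ Over.mk b).hom (Over.mk b).hom
        (pullback.map A.X.hom A.X.hom (Over.mk b).hom (Over.mk b).hom π π p HA.w HA.w) π p H2.w HA.w ≫ (fst (Over.mk b ⊗ Over.mk b) (Over.mk b) ≫ fst (Over.mk b) (Over.mk b)).left := by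
    simp only [Over.comp_left, Over.fst_left, Category.assoc, pullback.lift_fst_assoc, pullback.lift_fst]
  have c4 : (fst (A.X ⊗ A.X) A.X ≫ snd A.X A.X).left ≫ π =
      pullback.map (A.X ⊗ A.X).hom A.X.hom (Over.mk b ⊗ Over.mk b).hom (Over.mk b).hom
        (pullback.map A.X.hom A.X.hom (Over.mk b).hom (Over.mk b).hom π π p HA.w HA.w) π p H2.w HA.w ≫ (fst (Over.mk b ⊗ Over.mk b) (Over.mk b) ≫ snd (Over.mk b) (Over.mk b)).left := by
    simp only [Over.comp_left, Over.fst_left, Over.snd_left, Category.assoc, pullback.lift_fst_assoc,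
      pullback.lift_snd]
  have c5 : (lift (fst (A.X ⊗ A.X) A.X ≫ snd A.X A.X) (snd (A.X ⊗ A.X) A.X) ≫ μ[A.X]).left ≫ π =
      pullback.map (A.X ⊗ A.X).hom A.X.hom (Over.mk b ⊗ Over.mk b).hom (Over.mk b).hom
        (pullback.map A.X.hom A.X.hom (Over.mk b).hom (Over.mk b).hom π π p HA.w HA.w) π p H2.w HA.w ≫
        (lift (fst (Over.mk b ⊗ Over.mk b) (Over.mk b) ≫ snd (Over.mk b) (Over.mk b)) (snd (Over.mk b ⊗ Over.mk b) (Over.mk b)) ≫ μB).left := by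
    rw [Over.comp_left, Over.comp_left, ← Category.assoc,
      OverBaseMap.comp_lift_left p (fst (A.X ⊗ A.X) A.X ≫ snd A.X A.X) (snd (A.X ⊗ A.X) A.X) (fst (Over.mk b ⊗ Over.mk b) (Over.mk b) ≫ snd (Over.mk b) (Over.mk b))
        (snd (Over.mk b ⊗ Over.mk b) (Over.mk b)) _ π π HA.w HA.w c4 c2]
    simp only [Category.assoc, cμ]
  have L3 : lift (fst (Over.mk b ⊗ Over.mk b) (Over.mk b) ≫ μB) (snd (Over.mk b ⊗ Over.mk b) (Over.mk b)) ≫ μB =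
      lift (fst (Over.mk b ⊗ Over.mk b) (Over.mk b) ≫ fst (Over.mk b) (Over.mk b)) (lift (fst (Over.mk b ⊗ Over.mk b) (Over.mk b) ≫ snd (Over.mk b) (Over.mk b)) (snd (Over.mk b ⊗ Over.mk b) (Over.mk b)) ≫ μB) ≫ μB := by
    have lhs : pullback.map (A.X ⊗ A.X).hom A.X.hom (Over.mk b ⊗ Over.mk b).hom (Over.mk b).hom
        (pullback.map A.X.hom A.X.hom (Over.mk b).hom (Over.mk b).hom π π p HA.w HA.w) π p H2.w HA.w ≫ (lift (fst (Over.mk b ⊗ Over.mk b) (Over.mk b) ≫ μB) (snd (Over.mk b ⊗ Over.mk b) (Over.mk b))).left ≫ μB.left =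
        (lift (fst (A.X ⊗ A.X) A.X ≫ μ[A.X]) (snd (A.X ⊗ A.X) A.X) ≫ μ[A.X]).left ≫ π := by
      rw [← Category.assoc, OverBaseMap.comp_lift_left p (fst (A.X ⊗ A.X) A.X ≫ μ[A.X]) (snd (A.X ⊗ A.X) A.X)
        (fst (Over.mk b ⊗ Over.mk b) (Over.mk b) ≫ μB) (snd (Over.mk b ⊗ Over.mk b) (Over.mk b)) _ π π HA.w HA.w c1 c2, Category.assoc, cμ, ← Category.assoc,
        ← Over.comp_left]
    have rhs : pullback.map (A.X ⊗ A.X).hom A.X.hom (Over.mk b ⊗ Over.mk b).hom (Over.mk b).hom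
        (pullback.map A.X.hom A.X.hom (Over.mk b).hom (Over.mk b).hom π π p HA.w HA.w) π p H2.w HA.w ≫
        (lift (fst (Over.mk b ⊗ Over.mk b) (Over.mk b) ≫ fst (Over.mk b) (Over.mk b)) (lift (fst (Over.mk b ⊗ Over.mk b) (Over.mk b) ≫ snd (Over.mk b) (Over.mk b)) (snd (Over.mk b ⊗ Over.mk b) (Over.mk b)) ≫ μB)).left ≫
          μB.left =
        (lift (fst (A.X ⊗ A.X) A.X ≫ fst A.X A.X) (lift (fst (A.X ⊗ A.X) A.X ≫ snd A.X A.X) (snd (A.X ⊗ A.X) A.X) ≫ μ[A.X]) ≫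
          μ[A.X]).left ≫ π := by
      rw [← Category.assoc, OverBaseMap.comp_lift_left p (fst (A.X ⊗ A.X) A.X ≫ fst A.X A.X)
        (lift (fst (A.X ⊗ A.X) A.X ≫ snd A.X A.X) (snd (A.X ⊗ A.X) A.X) ≫ μ[A.X]) (fst (Over.mk b ⊗ Over.mk b) (Over.mk b) ≫ fst (Over.mk b) (Over.mk b))
        (lift (fst (Over.mk b ⊗ Over.mk b) (Over.mk b) ≫ snd (Over.mk b) (Over.mk b)) (snd (Over.mk b ⊗ Over.mk b) (Over.mk b)) ≫ μB) _ π π HA.w HA.w c3 c5, Category.assoc, cμ,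
        ← Category.assoc, ← Over.comp_left]
    ext
    rw [Over.comp_left, Over.comp_left, ← cancel_epi (pullback.map (A.X ⊗ A.X).hom A.X.hom (Over.mk b ⊗ Over.mk b).hom (Over.mk b).hom
        (pullback.map A.X.hom A.X.hom (Over.mk b).hom (Over.mk b).hom π π p HA.w HA.w) π p H2.w HA.w), lhs, rhs, hA3]
  -- the monoid axioms in Mathlib's whiskered form
  have h_one_mul : ηB ▷ (Over.mk b) ≫ μB = (λ_ (Over.mk b)).hom := by
    have e : ηB ▷ (Over.mk b) = (λ_ (Over.mk b)).hom ≫ lift (toUnit (Over.mk b) ≫ ηB) (𝟙 (Over.mk b)) := by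
      rw [leftUnitor_hom, comp_lift, Category.comp_id, ← Category.assoc,
        toUnit_unique (snd _ _ ≫ toUnit _) (fst _ _), ← lift_whiskerRight, lift_fst_snd, Category.id_comp]
    rw [e, Category.assoc, L1, Category.comp_id]
  have h_mul_one : (Over.mk b) ◁ ηB ≫ μB = (ρ_ (Over.mk b)).hom := by
    have e : (Over.mk b) ◁ ηB = (ρ_ (Over.mk b)).hom ≫ lift (𝟙 (Over.mk b)) (toUnit (Over.mk b) ≫ ηB) := by
      rw [rightUnitor_hom, comp_lift, Category.comp_id, ← Category.assoc,
        toUnit_unique (fst _ _ ≫ toUnit _) (snd _ _), ← lift_whiskerLeft, lift_fst_snd, Category.id_comp]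
    rw [e, Category.assoc, L2, Category.comp_id]
  have h_mul_assoc : μB ▷ (Over.mk b) ≫ μB = (α_ (Over.mk b) (Over.mk b) (Over.mk b)).hom ≫ (Over.mk b) ◁ μB ≫ μB := by
    have e₁ : μB ▷ (Over.mk b) = lift (fst (Over.mk b ⊗ Over.mk b) (Over.mk b) ≫ μB) (snd (Over.mk b ⊗ Over.mk b) (Over.mk b)) := by
      rw [← lift_whiskerRight, lift_fst_snd, Category.id_comp]
    have e₂ : (α_ (Over.mk b) (Over.mk b) (Over.mk b)).hom ≫ (Over.mk b) ◁ μB =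
        lift (fst (Over.mk b ⊗ Over.mk b) (Over.mk b) ≫ fst (Over.mk b) (Over.mk b)) (lift (fst (Over.mk b ⊗ Over.mk b) (Over.mk b) ≫ snd (Over.mk b) (Over.mk b)) (snd (Over.mk b ⊗ Over.mk b) (Over.mk b)) ≫ μB) := by
      rw [← lift_whiskerLeft, ← lift_lift_associator_hom, ← comp_lift, lift_fst_snd, Category.comp_id,
        lift_fst_snd, Category.id_comp]
    rw [e₁, L3, ← Category.assoc, e₂]
  letI mon : MonObj (Over.mk b) :=
    { one := ηB, mul := μB, one_mul := h_one_mul, mul_one := h_mul_one, mul_assoc := h_mul_assoc }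
  -- ### (5) the inverse: `ι ≫ π` is `G`-invariant by uniqueness of inverses in the monoid `Hom_Q(A, B)`
  have W : (ι[A.X].left ≫ π) ≫ (Over.mk b).hom = A.X.hom ≫ p := by
    rw [Category.assoc, hb', ← Category.assoc, Over.w ι[A.X]]
  have P1 : pullback.lift (ι[A.X].left ≫ π) π (W.trans hb'.symm) = (lift ι[A.X] (𝟙 A.X)).left ≫ pullback.map A.X.hom A.X.hom (Over.mk b).hom (Over.mk b).hom π π p HA.w HA.w := by
    apply pullback.hom_ext
    · simp only [Over.lift_left, Over.id_left, Category.assoc, pullback.lift_fst, pullback.lift_fst_assoc]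
    · simp only [Over.lift_left, Over.id_left, Category.assoc, pullback.lift_snd, pullback.lift_snd_assoc,
        Category.id_comp]
  have P2 : pullback.lift π (ι[A.X].left ≫ π) (hb'.trans W.symm) = (lift (𝟙 A.X) ι[A.X]).left ≫ pullback.map A.X.hom A.X.hom (Over.mk b).hom (Over.mk b).hom π π p HA.w HA.w := by
    apply pullback.hom_ext
    · simp only [Over.lift_left, Over.id_left, Category.assoc, pullback.lift_fst, pullback.lift_fst_assoc,
        Category.id_comp]
    · simp only [Over.lift_left, Over.id_left, Category.assoc, pullback.lift_snd, pullback.lift_snd_assoc]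
  have hli : ∀ {Z : Scheme.{u}} (f : A.X.left ⟶ Z),
      (lift ι[A.X] (𝟙 A.X)).left ≫ μ[A.X].left ≫ f = A.X.hom ≫ η[A.X].left ≫ f := fun f => by
    rw [← Category.assoc, ← Over.comp_left, GrpObj.left_inv, Over.comp_left, Over.toUnit_left, Category.assoc]
  have hri : ∀ {Z : Scheme.{u}} (f : A.X.left ⟶ Z),
      (lift (𝟙 A.X) ι[A.X]).left ≫ μ[A.X].left ≫ f = A.X.hom ≫ η[A.X].left ≫ f := fun f => by
    rw [← Category.assoc, ← Over.comp_left, GrpObj.right_inv, Over.comp_left, Over.toUnit_left, Category.assoc]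
  let AQ : Over Q := Over.mk (A.X.hom ≫ p)
  let πQ : AQ ⟶ (Over.mk b) := Over.homMk π hb'
  let v : AQ ⟶ (Over.mk b) := Over.homMk (ι[A.X].left ≫ π) W
  have hv : πQ * v = 1 := by
    ext
    rw [Hom.mul_def, Hom.one_def, Over.comp_left, Over.comp_left, Over.lift_left, Over.toUnit_left]
    change pullback.lift π (ι[A.X].left ≫ π) _ ≫ mB = (A.X.hom ≫ p) ≫ nB
    rw [P2]
    simp only [Category.assoc, hmB, hri, hnB]
  have hinvι : ∀ g : G, (ρA.aut g).hom ≫ (ι[A.X].left ≫ π) = ι[A.X].left ≫ π := by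
    intro g
    have Wu : ((ρA.aut g).hom ≫ ι[A.X].left ≫ π) ≫ (Over.mk b).hom = A.X.hom ≫ p := by
      rw [Category.assoc, W, ← Category.assoc, hw g, Category.assoc, ρ.aut_comp]
    let u : AQ ⟶ (Over.mk b) := Over.homMk ((ρA.aut g).hom ≫ ι[A.X].left ≫ π) Wu
    have P0 : pullback.lift ((ρA.aut g).hom ≫ ι[A.X].left ≫ π) π (Wu.trans hb'.symm) =
        (ρA.aut g).hom ≫ pullback.lift (ι[A.X].left ≫ π) π (W.trans hb'.symm) := by
      apply pullback.hom_ext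
      · simp only [Category.assoc, pullback.lift_fst]
      · simp only [Category.assoc, pullback.lift_snd, ρA.aut_comp]
    have hu : u * πQ = 1 := by
      ext
      rw [Hom.mul_def, Hom.one_def, Over.comp_left, Over.comp_left, Over.lift_left, Over.toUnit_left]
      change pullback.lift ((ρA.aut g).hom ≫ ι[A.X].left ≫ π) π _ ≫ mB = (A.X.hom ≫ p) ≫ nB
      rw [P0, P1]
      simp only [Category.assoc, hmB, hli, reassoc_of% (hw g), hinvη, hnB]
    have key : u = v := by rw [← _root_.mul_one u, ← hv, ← _root_.mul_assoc, hu, _root_.one_mul]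
    exact congrArg (fun f : AQ ⟶ (Over.mk b) => f.left) key
  obtain ⟨iB, hiB⟩ : ∃ iB : B₀ ⟶ B₀, π ≫ iB = ι[A.X].left ≫ π := ⟨hπ.desc _ hinvι, hπ.comp_desc _ hinvι⟩
  have hiBw : iB ≫ (Over.mk b).hom = (Over.mk b).hom := by
    rw [← cancel_epi π, reassoc_of% hiB, hb', ← Category.assoc, Over.w ι[A.X]]
  let ιB : (Over.mk b) ⟶ (Over.mk b) := Over.homMk iB hiBw
  have P3 : π ≫ (lift ιB (𝟙 (Over.mk b))).left = (lift ι[A.X] (𝟙 A.X)).left ≫ pullback.map A.X.hom A.X.hom (Over.mk b).hom (Over.mk b).hom π π p HA.w HA.w := by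
    rw [← P1]
    apply pullback.hom_ext
    · simp only [Over.lift_left, Over.id_left, Category.assoc, pullback.lift_fst]; exact hiB
    · simp only [Over.lift_left, Over.id_left, Category.assoc, pullback.lift_snd]; exact Category.comp_id π
  have P4 : π ≫ (lift (𝟙 (Over.mk b)) ιB).left = (lift (𝟙 A.X) ι[A.X]).left ≫ pullback.map A.X.hom A.X.hom (Over.mk b).hom (Over.mk b).hom π π p HA.w HA.w := by
    rw [← P2]
    apply pullback.hom_ext
    · simp only [Over.lift_left, Over.id_left, Category.assoc, pullback.lift_fst]; exact Category.comp_id π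
    · simp only [Over.lift_left, Over.id_left, Category.assoc, pullback.lift_snd]; exact hiB
  have h1B : π ≫ (toUnit (Over.mk b) ≫ η[(Over.mk b)]).left = (toUnit A.X ≫ η[A.X]).left ≫ π := cη.symm
  have cμ' : pullback.map A.X.hom A.X.hom (Over.mk b).hom (Over.mk b).hom π π p HA.w HA.w ≫ μ[(Over.mk b)].left =
      μ[A.X].left ≫ π := hmB
  have h_left_inv : lift ιB (𝟙 (Over.mk b)) ≫ μ[(Over.mk b)] = toUnit (Over.mk b) ≫ η[(Over.mk b)] := by
    ext
    rw [Over.comp_left, ← cancel_epi π, reassoc_of% P3, cμ', ← Category.assoc, ← Over.comp_left,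
      GrpObj.left_inv, h1B]
  have h_right_inv : lift (𝟙 (Over.mk b)) ιB ≫ μ[(Over.mk b)] = toUnit (Over.mk b) ≫ η[(Over.mk b)] := by
    ext
    rw [Over.comp_left, ← cancel_epi π, reassoc_of% P4, cμ', ← Category.assoc, ← Over.comp_left,
      GrpObj.right_inv, h1B]
  let grp : GrpObj (Over.mk b) := { inv := ιB, left_inv := h_left_inv, right_inv := h_right_inv }
  -- ### (6) proper, smooth, geometrically connected — descent along `p`
  haveI := A.isProper
  haveI := A.isSmooth
  haveI := A.geometricallyConnected
  haveI hsep : IsSeparated (Over.mk b).hom :=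
    Literature.AlgebraicGeometry.LaurentSchroer2023.isSeparated_of_isPullback HA
  have hpr : IsProper b := Literature.AlgebraicGeometry.Morphisms.isProper_of_isPullback HA
  have hsm : Smooth b :=
    MorphismProperty.of_isPullback_of_descendsAlong (P := @Smooth) (Q := @Surjective ⊓ @Flat ⊓ @QuasiCompact)
      HA ⟨⟨‹Surjective p›, ‹Flat p›⟩, ‹QuasiCompact p›⟩ A.isSmooth
  have hgc : GeometricallyConnected b :=
    Literature.AlgebraicGeometry.Morphisms.geometricallyConnected_of_isPullback_of_surjective HA
  -- ### (7) the base-change relation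
  exact ⟨grp, hpr, hsm, hgc, hb', HA.flip, hnB.symm, cμ.symm⟩

end Literature.AlgebraicGeometry.AbelianSchemes.AbelianSchemeOver

end
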